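import Mathlib.Topology.Homotopy.Lifting
import Mathlib.Analysis.Convex.Contractible
import Mathlib.Topology.Algebra.Module.LocallyConvex
import Mathlib.Topology.Instances.RealVectorSpace
import Mathlib.Analysis.SpecialFunctions.Complex.Circle
import Literature.AlgebraicGeometry.Frobenioids.CircleOpensProofs
import HarnessLib

/-!
# Frobenioids II, Lemma 3.2: proofs of (xi) and (xii) (divisible elements, normalizers)

Mochizuki, *The geometry of Frobenioids II*, Kyushu J. Math. **62** (2008) 401–460, §3, Lemma 3.2
pp. 26–27 [cite: MochizukiFrdII2008, Lem 3.2 pp.26-27]. Discharges (proof-only companion) of the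
named facts `ItemXI`, `ItemXII_divisible`, `ItemXII_normalizer` of `CircleOpens.lean`
(abc-iut-L1-t4).

Proof notes. (xi) "Assertion (xi) follows, for instance, by considering the induced automorphism
of `π₁(S¹) ≅ ℤ`" (p. 26): here, a continuous automorphism `f` of `S¹` composed with the covering
`exp : ℝ → S¹` lifts (Mathlib `IsCoveringMap.existsUnique_continuousMap_lifts`, `ℝ` simply
connected) to a continuous `g : ℝ → ℝ` with `g(0) = 0`; `g` is additive (its additivity defect is
a continuous function into `2πℤ`), hence `g(t) = kt` with `k ∈ ℤ` (`exp(2πik) = 1`), so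
`f = φ_k`, and injectivity forces `k = ±1`. (xii): the translations are divisible
(`τ_{exp(it)} = τ_{exp(it/n)}ⁿ`) while a reflection `τ_w φ_{-1}` squares to `1 ∉` ... is not even a
square in `Refl(S¹)` (every square in `Refl(S¹)` is a translation); an element of `Homeo(S¹)`
normalizing `Trans(S¹)` induces a continuous automorphism `σ` of `S¹ ≅ Trans(S¹)`, so `σ = φ_{±1}`
by (xi), whence `α` or `φ_{-1} α` centralizes `Trans(S¹)`, i.e. is a translation (p. 27); the
normalizer of `Refl(S¹)` normalizes its characteristic subgroup of squares `Trans(S¹)`.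
-/

namespace Literature.AlgebraicGeometry.Frobenioids

open Set Function Topology Real
open scoped Pointwise

noncomputable section

namespace CircleOpens

/-! ### Lemma 3.2 (xii): `Trans(S¹)` is the set of infinitely divisible elements of `Refl(S¹)` -/

/-- `τ_wⁿ = τ_{wⁿ}`. [cite: MochizukiFrdII2008, Lem 3.2 (xii) p.26] -/
theorem translation_pow (w : Circle) (n : ℕ) : translation w ^ n = translation (w ^ n) :=
  (map_pow translationHom w n).symm

/-- A reflection `τ_v φ_{-1}` squares to the identity. [cite: MochizukiFrdII2008, Lem 3.2 (xii) p.26] -/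
theorem translation_mul_inversion_mul_self (v : Circle) :
    translation v * inversion * (translation v * inversion) = 1 := by
  nth_rw 1 [← translation_mul_inversion_inv v]
  exact inv_mul_cancel _

/-- An element of `Homeo(S¹)` is a translation iff it lies in `Refl(S¹)` and is a square there.
[cite: MochizukiFrdII2008, Lem 3.2 (xii) p.26] -/
theorem mem_trans_iff_exists_sq {f : Homeo} :
    f ∈ trans ↔ f ∈ refl ∧ ∃ g ∈ refl, g * g = f := by
  constructor
  · rintro ⟨w, rfl⟩
    refine ⟨trans_le_refl (translation_mem_trans w), ?_⟩
    obtain ⟨t, rfl⟩ := Circle.exp_surjective w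
    refine ⟨translation (Circle.exp (t / 2)), trans_le_refl (translation_mem_trans _), ?_⟩
    show translation _ * translation _ = translation _
    rw [translation_mul, ← Circle.exp_add, add_halves]
  · rintro ⟨-, g, hg, rfl⟩
    obtain ⟨v, rfl | rfl⟩ := exists_eq_translation_or_of_mem_refl hg
    · rw [translation_mul]; exact translation_mem_trans _
    · rw [translation_mul_inversion_mul_self]; exact trans.one_mem

/-- **Lemma 3.2 (xii)**, divisible elements (FrdII p. 26), PROVED: "`Trans(S¹) ⊆ Refl(S¹)` is equal
to the subgroup of infinitely divisible elements." [cite: MochizukiFrdII2008, Lem 3.2 (xii) p.26] -/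
theorem ItemXII_divisible_holds : ItemXII_divisible := by
  intro f
  constructor
  · rintro ⟨w, rfl⟩
    refine ⟨trans_le_refl (translation_mem_trans w), fun n hn => ?_⟩
    obtain ⟨t, rfl⟩ := Circle.exp_surjective w
    refine ⟨translation (Circle.exp (t / n)), trans_le_refl (translation_mem_trans _), ?_⟩
    show translation (Circle.exp (t / n)) ^ n = translation (Circle.exp t)
    rw [translation_pow, ← Circle.exp_nsmul, nsmul_eq_mul,
      mul_div_cancel₀ _ (Nat.cast_ne_zero.mpr hn.ne')]
  · rintro ⟨hf, hroots⟩
    obtain ⟨g, hg, hg2⟩ := hroots 2 two_pos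
    exact mem_trans_iff_exists_sq.mpr ⟨hf, g, hg, by rw [← hg2, pow_two]⟩

/-! ### Lemma 3.2 (xi): automorphisms of the topological group `S¹` -/

/-- **Lemma 3.2 (xi)** (FrdII p. 26), PROVED: "Every automorphism of the topological group `S¹` is
equal to either `φ_1` or `φ_{-1}`" (via the lift through the covering `exp : ℝ → S¹`, i.e. "the
induced automorphism of `π₁(S¹) ≅ ℤ`"). [cite: MochizukiFrdII2008, Lem 3.2 (xi) p.26] -/
theorem ItemXI_holds : ItemXI := by
  intro f
  have hfc : Continuous f := f.toHomeomorph.continuous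
  have hf1 : f 1 = 1 := map_one f
  set F : C(ℝ, Circle) := ⟨fun t => f (Circle.exp t), hfc.comp Circle.exp.continuous⟩ with hF
  obtain ⟨g, ⟨hg0, hg⟩, -⟩ := Circle.isCoveringMap_exp.existsUnique_continuousMap_lifts F 0 0
    (by simp [hF, hf1])
  have hgF : ∀ t, Circle.exp (g t) = f (Circle.exp t) := fun t => by
    have := congr_fun hg t
    simpa [hF] using this
  -- additivity of the lift
  have hdisc : IsDiscrete (AddSubgroup.zmultiples (2 * π) : Set ℝ) :=
    isDiscrete_iff_discreteTopology.mpr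
      (inferInstanceAs (DiscreteTopology (AddSubgroup.zmultiples (2 * π))))
  have hadd : ∀ s t, g (s + t) = g s + g t := by
    have hD : ∀ p : ℝ × ℝ,
        g (p.1 + p.2) - g p.1 - g p.2 ∈ (AddSubgroup.zmultiples (2 * π) : Set ℝ) := by
      intro p
      have : Circle.exp (g (p.1 + p.2)) = Circle.exp (g p.1 + g p.2) := by
        rw [Circle.exp_add, hgF, hgF, hgF, Circle.exp_add, map_mul]
      obtain ⟨m, hm⟩ := Circle.exp_eq_exp.mp this
      exact ⟨m, by show (m : ℤ) • (2 * π) = _; rw [zsmul_eq_mul]; linarith⟩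
    have hcont : Continuous fun p : ℝ × ℝ => g (p.1 + p.2) - g p.1 - g p.2 := by fun_prop
    intro s t
    have h := (isPreconnected_univ (α := ℝ × ℝ)).constant_of_mapsTo hdisc hcont.continuousOn
      (fun p _ => hD p) (mem_univ (s, t)) (mem_univ ((0 : ℝ), (0 : ℝ)))
    simp only [add_zero, hg0, sub_zero] at h
    linarith
  -- the lift is linear: `g t = t · g 1`
  have hlin : ∀ t, g t = t * g 1 := by
    intro t
    have := map_real_smul (AddMonoidHom.mk' g hadd) g.continuous t 1
    simpa [smul_eq_mul] using this
  -- `g 1` is an integer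
  obtain ⟨k, hk⟩ : ∃ k : ℤ, g 1 = k := by
    have h1 : Circle.exp (g (2 * π)) = 1 := by
      rw [hgF, ← zero_add (2 * π), Circle.exp_add_two_pi, Circle.exp_zero, hf1]
    rw [hlin] at h1
    obtain ⟨n, hn⟩ := Circle.exp_eq_one.mp h1
    exact ⟨n, mul_left_cancel₀ two_pi_pos.ne' (by rw [hn]; ring)⟩
  -- hence `f = φ_k`
  have hfk : ∀ z, f z = phi k z := by
    intro z
    obtain ⟨t, rfl⟩ := Circle.exp_surjective z
    rw [← hgF, hlin, hk, phi, ← Circle.exp_zsmul, zsmul_eq_mul, mul_comm]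
  -- and `k = ±1` by injectivity
  have hk1 : k = 1 ∨ k = -1 := by
    by_contra hne
    rcases eq_or_ne k 0 with rfl | hk0
    · refine Circle.exp_pi_ne_one (f.injective ?_)
      rw [hfk, hfk]
      simp [phi]
    · have hz : Circle.exp (2 * π / k) ≠ 1 := by
        intro h
        obtain ⟨n, hn⟩ := Circle.exp_eq_one.mp h
        rw [div_eq_iff (Int.cast_ne_zero.mpr hk0)] at hn
        have h3 : ((n : ℝ) * k) * (2 * π) = 1 * (2 * π) := by linear_combination -hn
        have h4 : (n : ℝ) * k = 1 := mul_right_cancel₀ two_pi_pos.ne' h3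
        have h5 : n * k = 1 := by exact_mod_cast h4
        rcases Int.eq_one_or_neg_one_of_mul_eq_one' h5 with ⟨-, h⟩ | ⟨-, h⟩
        · exact hne (Or.inl h)
        · exact hne (Or.inr h)
      refine hz (f.injective ?_)
      rw [hfk, hfk]
      show phi k (Circle.exp (2 * π / k)) = phi k 1
      rw [phi, phi, one_zpow, ← Circle.exp_zsmul, zsmul_eq_mul,
        mul_div_cancel₀ _ (Int.cast_ne_zero.mpr hk0), ← zero_add (2 * π), Circle.exp_add_two_pi,
        Circle.exp_zero]
  rcases hk1 with rfl | rfl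
  · exact Or.inl hfk
  · exact Or.inr hfk

/-! ### Lemma 3.2 (xii): normalizers -/

/-- `Refl(S¹)` normalizes `Trans(S¹)` (as a set). [cite: MochizukiFrdII2008, Lem 3.2 (xii) p.26] -/
theorem refl_le_normalizer_trans : refl ≤ Subgroup.normalizer (trans : Set Homeo) := by
  intro f hf h
  constructor
  · rintro ⟨v, rfl⟩
    exact conj_translation_mem_trans hf v
  · intro hc
    obtain ⟨u, hu⟩ := hc
    have : h = f⁻¹ * translation u * f⁻¹⁻¹ := by rw [inv_inv, hu]; group
    rw [this]
    exact conj_translation_mem_trans (refl.inv_mem hf) u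

/-- A subgroup normalizes itself (as a set). [cite: MochizukiFrdII2008, Lem 3.2 (xii) p.26] -/
theorem refl_le_normalizer_refl : refl ≤ Subgroup.normalizer (refl : Set Homeo) := by
  intro f hf h
  constructor
  · intro hh
    exact refl.mul_mem (refl.mul_mem hf hh) (refl.inv_mem hf)
  · intro hc
    have : h = f⁻¹ * (f * h * f⁻¹) * f := by group
    rw [this]
    exact refl.mul_mem (refl.mul_mem (refl.inv_mem hf) hc) hf

section Normalizer

variable {α : Homeo} (hα : α ∈ Subgroup.normalizer (trans : Set Homeo))

include hα in
/-- `α ∘ τ_w ∘ α⁻¹ = τ_{σ_α(w)}` with `σ_α(w) := α(w · α⁻¹(1))`, for `α` in the normalizer of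
`Trans(S¹)`. [cite: MochizukiFrdII2008, Lem 3.2 (xii) p.27] -/
theorem conj_translation_eq (w : Circle) :
    α * translation w * α⁻¹ = translation (α (w * α.symm 1)) := by
  obtain ⟨u, hu⟩ := (hα (translation w)).mp (translation_mem_trans w)
  have : u = α (w * α.symm 1) := by
    have := congrArg (fun f : Homeo => f 1) hu
    simp only [Homeomorph.mul_apply, Homeomorph.inv_apply, translation_apply, mul_one] at this
    exact this
  rw [← hu, this]

include hα in
/-- `σ_α` is multiplicative. [cite: MochizukiFrdII2008, Lem 3.2 (xii) p.27] -/
theorem conjFun_mul (v w : Circle) :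
    α (v * w * α.symm 1) = α (v * α.symm 1) * α (w * α.symm 1) := by
  apply translationHom_injective
  show translation (α (v * w * α.symm 1)) = translation (α (v * α.symm 1) * α (w * α.symm 1))
  rw [← conj_translation_eq hα, ← translation_mul, ← translation_mul, ← conj_translation_eq hα,
    ← conj_translation_eq hα]
  group

include hα in
/-- `σ_{α⁻¹} ∘ σ_α = id`. [cite: MochizukiFrdII2008, Lem 3.2 (xii) p.27] -/
theorem conjFun_inv_conjFun (w : Circle) : α⁻¹ (α (w * α.symm 1) * α⁻¹.symm 1) = w := by
  have hα' : α⁻¹ ∈ Subgroup.normalizer (trans : Set Homeo) := Subgroup.inv_mem _ hα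
  apply translationHom_injective
  show translation (α⁻¹ (α (w * α.symm 1) * α⁻¹.symm 1)) = translation w
  rw [← conj_translation_eq hα', ← conj_translation_eq hα]
  group

include hα in
/-- An element of `Homeo(S¹)` normalizing `Trans(S¹)` lies in `Refl(S¹)`: it induces, through
`Trans(S¹) ≅ S¹`, a continuous automorphism `σ_α` of `S¹`, which is `φ_{±1}` by (xi); then `α`
(resp. `φ_{-1} α`) centralizes `Trans(S¹)`, hence is a translation by (xii) (p. 27).
[cite: MochizukiFrdII2008, Lem 3.2 (xii) p.27] -/
theorem mem_refl_of_mem_normalizer_trans : α ∈ refl := by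
  have hα' : α⁻¹ ∈ Subgroup.normalizer (trans : Set Homeo) := Subgroup.inv_mem _ hα
  let σ : Circle ≃ₜ* Circle :=
    { toFun := fun w => α (w * α.symm 1)
      invFun := fun w => α⁻¹ (w * α⁻¹.symm 1)
      left_inv := conjFun_inv_conjFun hα
      right_inv := fun w => by
        have h := conjFun_inv_conjFun hα' w
        rwa [inv_inv] at h
      map_mul' := conjFun_mul hα
      continuous_toFun := α.continuous.comp (continuous_id.mul continuous_const)
      continuous_invFun := α⁻¹.continuous.comp (continuous_id.mul continuous_const) }
  have hσ : ∀ w, σ w = α (w * α.symm 1) := fun w => rfl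
  rcases ItemXI_holds σ with h | h
  · -- `σ = id`: `α` centralizes the translations
    have hc : α ∈ Subgroup.centralizer (trans : Set Homeo) := by
      rw [Subgroup.mem_centralizer_iff]
      rintro _ ⟨w, rfl⟩
      have e := conj_translation_eq hα w
      have hw : α (w * α.symm 1) = w := by rw [← hσ, h w]; simp [phi]
      rw [hw] at e
      have e' := congrArg (· * α) e
      simp only [inv_mul_cancel_right] at e'
      show translation w * α = α * translation w
      exact e'.symm
    rw [ItemXII_centralizer_holds] at hc
    exact trans_le_refl hc
  · -- `σ = φ_{-1}`: `φ_{-1} α` centralizes the translations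
    have hc : inversion * α ∈ Subgroup.centralizer (trans : Set Homeo) := by
      rw [Subgroup.mem_centralizer_iff]
      rintro _ ⟨w, rfl⟩
      have e := conj_translation_eq hα w
      have hw : α (w * α.symm 1) = w⁻¹ := by rw [← hσ, h w]; simp [phi]
      rw [hw] at e
      have e' := congrArg (· * α) e
      simp only [inv_mul_cancel_right] at e'
      show translation w * (inversion * α) = inversion * α * translation w
      calc translation w * (inversion * α) = translation w * inversion * α := (mul_assoc _ _ _).symm
        _ = inversion * translation w⁻¹ * α := by rw [inversion_mul_translation, inv_inv]
        _ = inversion * (translation w⁻¹ * α) := mul_assoc _ _ _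
        _ = inversion * (α * translation w) := by rw [e']
        _ = inversion * α * translation w := (mul_assoc _ _ _).symm
    rw [ItemXII_centralizer_holds] at hc
    have : α = inversion * (inversion * α) := by rw [← mul_assoc, inversion_mul_inversion, one_mul]
    rw [this]
    exact refl.mul_mem inversion_mem_refl (trans_le_refl hc)

end Normalizer

/-- **Lemma 3.2 (xii)**, normalizers (FrdII p. 26), PROVED: "the normalizer in `Homeo(S¹)` of
either `Trans(S¹)` or `Refl(S¹)` is equal to `Refl(S¹)`."
[cite: MochizukiFrdII2008, Lem 3.2 (xii) pp.26-27] -/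
theorem ItemXII_normalizer_holds : ItemXII_normalizer := by
  have h1 : Subgroup.normalizer (trans : Set Homeo) = refl :=
    le_antisymm (fun α hα => mem_refl_of_mem_normalizer_trans hα) refl_le_normalizer_trans
  refine ⟨h1, le_antisymm (fun α hα => ?_) refl_le_normalizer_refl⟩
  rw [← h1]
  -- `α` normalizes the characteristic subset of squares of `Refl(S¹)`, i.e. `Trans(S¹)`
  have key : ∀ β : Homeo, β ∈ Subgroup.normalizer (refl : Set Homeo) →
      ∀ h : Homeo, h ∈ trans → β * h * β⁻¹ ∈ trans := by
    intro β hβ h hh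
    obtain ⟨hr, g, hg, rfl⟩ := mem_trans_iff_exists_sq.mp hh
    refine mem_trans_iff_exists_sq.mpr ⟨(hβ _).mp hr, β * g * β⁻¹, (hβ g).mp hg, by group⟩
  intro h
  constructor
  · exact key α hα h
  · intro hc
    have := key α⁻¹ (Subgroup.inv_mem _ hα) _ hc
    simpa [mul_assoc] using this

end CircleOpens

end

end Literature.AlgebraicGeometry.Frobenioids
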